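import Summits.Ventures.HodgeRepro.TwoPowerPairing
import Summits.Ventures.HodgeRepro.CyclicPrimePowerNoSingleClass

/-!
# `C_{2^(a+1)} × C₂` with `c` in the cyclic factor: no single-class `SumTwo` quadruple without a conjugate pair

Blind re-derivation cell `pub-hodge-repro`, seat `p1` (gen 11).  The abelian census of gen 10 (P1.md §16b–§16g)
left ONE family outside the five mechanisms (A)–(E) whose emptiness was only a paper proof: `(C_{2^(a+1)} × C₂, c)`
with `c = (2^a, 0)` in the cyclic factor — census EMPTY at `a = 2, 3` (`C₈ × C₂`, `C₁₆ × C₂`) and UNDECIDED at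
`a = 4` (`C₃₂ × C₂`: 30 of 9,952 pointed `4`-sets hit the solution cap of job j160088).  This file settles the
family for EVERY `a` on the kernel, by a reduction to the cyclic theorem of gen 8 instead of a product-group Fourier
toolkit:

**Theorem** (`exists_conj_of_sumTwo_kleinPair`, abstract form).  Let `(G, c)` be finite with two surjections
`φ₀, φ₁ : G →* ℤ/N`, `N = 2 · 2^a`, both sending `c` to `N/2`, with kernels `{1, κ₀}` and `{1, κ₁}` where
`κ₁ = κ₀ c`.  Then every `SumTwo` quadruple of Galois twists of a CM type has two complex-conjugate corners.
(`G = C_{2^(a+1)} × C₂` with `φ₀ = pr₁`, `φ₁ = pr₁ + 2^a · pr₂`, `κ₀ = (0,1)`, `κ₁ = (2^a, 1)`: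
`exists_conj_of_sumTwo_twoPowerTimesTwo`, `not_isSingleClass_twoPowerTimesTwo`; instances `C₄ × C₂ … C₆₄ × C₂`.)

Proof.  Push the indicator of `Φ` forward along `φᵢ`: `Pᵢ(x) = #{z ∈ Φ : φᵢ z = x}` is a CM profile on `ℤ/N`
(`push_add_half`: the fibre over `x + N/2` is `c` times the fibre over `x`) and `∑ⱼ Pᵢ(x − φᵢ(gⱼ)) = 4`
(`sum_push_twists`: `SumTwo` at the two points of a fibre).  By `pairing_or_const` (`TwoPowerPairing.lean`) each
profile is either `≡ 1` or pairs the four points `φᵢ(gⱼ)` with differences `N/2`.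
* `P₀ ≡ 1` means `1_Φ(z) + 1_Φ(κ₀ z) = 1`, i.e. `Φ` is `κ₀ c = κ₁`-periodic (`periodic_of_push_eq_one`); then
  `Φ = φ₁⁻¹(φ₁ Φ)` and the quadruple descends along `φ₁` to a `SumTwo` quadruple of twists of the CM type `φ₁ Φ`
  on `(ℤ/N, N/2)`, which has a conjugate pair by gen 8's `exists_conj_of_sumTwo_cyclic` (`N = 2 · 2^a · 3^0`);
  the pair pulls back (`exists_conj_of_periodic`).  Symmetrically for `P₁ ≡ 1` (descent along `φ₀`).
* Both pairings: a pair `{gᵢ, gⱼ}` of the `φ₀`-pairing has `gᵢ gⱼ⁻¹ ∈ φ₀⁻¹(N/2) = {c, κ₁}`, and `gᵢ gⱼ⁻¹ = c` is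
  a conjugate pair (`rmul_mul_conj`), so `gᵢ gⱼ⁻¹ = κ₁` on both pairs (`mul_inv_eq_kappa`); likewise `= κ₀` on
  the two pairs of the `φ₁`-pairing.  The two perfect matchings of `{0,1,2,3}` differ (`κ₀ ≠ κ₁`), and along a path
  `gᵢ —κ₁— gⱼ —κ₀— gₖ` one gets `gᵢ gₖ⁻¹ = κ₁ κ₀ = c`: a conjugate pair after all.
-/

set_option autoImplicit false

open Finset AddChar ZMod Function
open scoped Pointwise

namespace HodgeRepro.TwoPowerTimesTwo

open HodgeRepro.CyclicQuad

variable {G : Type*} [Group G] [DecidableEq G] {N : ℕ} [NeZero N]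

/-! ### Twisting by a complex conjugation -/

/-- `Φ (c h) = c • Φ h` for a central involution `c`. -/
theorem rmul_mul_conj {c : G} (hc : IsComplexConj c) (Φ : Finset G) (h : G) :
    rmul Φ (c * h) = c • rmul Φ h := by
  ext x
  rw [hc.mem_smul_iff, mem_rmul, mem_rmul, mul_inv_rev, hc.inv_eq, ← mul_assoc, ← hc.comm, mul_assoc]

/-! ### The push-forward profile of a CM type along a surjection with kernel `{1, κ}` -/

/-- The push-forward of the indicator of `Φ` along `φ`: `push φ Φ x = #{z ∈ Φ : φ z = x}`. -/
noncomputable def push (φ : G →* Multiplicative (ZMod N)) (Φ : Finset G) (x : ZMod N) : ℂ :=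
  ((Φ.filter fun z => φ z = Multiplicative.ofAdd x).card : ℂ)

omit [NeZero N] in
/-- With `ker φ = {1, κ}`, the fibre of `φ` through `w` inside `Φ` is `{w, κ w} ∩ Φ`. -/
theorem filter_eq_pair (φ : G →* Multiplicative (ZMod N)) {κ : G}
    (hker : ∀ z, φ z = 1 ↔ z = 1 ∨ z = κ) (Φ : Finset G) (w : G) :
    (Φ.filter fun z => φ z = φ w) = ({w, κ * w} : Finset G).filter (· ∈ Φ) := by
  ext z
  simp only [mem_filter, mem_insert, mem_singleton]
  constructor
  · rintro ⟨hz, hφ⟩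
    have h1 : φ (z * w⁻¹) = 1 := by rw [map_mul, map_inv, hφ, mul_inv_cancel]
    rcases (hker _).mp h1 with h2 | h2
    · exact ⟨Or.inl (mul_inv_eq_one.mp h2), hz⟩
    · exact ⟨Or.inr (by rw [← h2, inv_mul_cancel_right]), hz⟩
  · rintro ⟨h1 | h1, hz⟩
    · exact ⟨hz, by rw [h1]⟩
    · refine ⟨hz, ?_⟩
      rw [h1, map_mul, (hker κ).mpr (Or.inr rfl), one_mul]

omit [NeZero N] in
/-- `push φ Φ (φ w)` counts which of `w`, `κ w` lie in `Φ`. -/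
theorem push_apply (φ : G →* Multiplicative (ZMod N)) {κ : G}
    (hker : ∀ z, φ z = 1 ↔ z = 1 ∨ z = κ) (hκ : κ ≠ 1) (Φ : Finset G) (w : G) :
    push φ Φ (Multiplicative.toAdd (φ w)) =
      (if w ∈ Φ then 1 else 0) + (if κ * w ∈ Φ then 1 else 0) := by
  unfold push
  rw [ofAdd_toAdd, filter_eq_pair φ hker, Finset.card_filter,
    Finset.sum_pair (fun h => hκ (right_eq_mul.mp h)), Nat.cast_add]
  simp only [Nat.cast_ite, Nat.cast_one, Nat.cast_zero]

omit [NeZero N] in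
/-- The push-forward of a CM type is a CM profile: `push φ Φ (x + N/2) = 2 − push φ Φ x`. -/
theorem push_add_half (φ : G →* Multiplicative (ZMod N)) (hφ : Surjective φ) {κ : G}
    (hker : ∀ z, φ z = 1 ↔ z = 1 ∨ z = κ) (hκ : κ ≠ 1) {c : G} (hc : IsComplexConj c) {m : ℕ}
    (hcm : φ c = Multiplicative.ofAdd (m : ZMod N)) (Φ : Finset G) (hΦ : IsCMType c Φ) (x : ZMod N) :
    push φ Φ (x + m) = 2 - push φ Φ x := by
  obtain ⟨w, hw⟩ := hφ (Multiplicative.ofAdd x)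
  have e1 : x = Multiplicative.toAdd (φ w) := by rw [hw, toAdd_ofAdd]
  subst e1
  have e2 : Multiplicative.toAdd (φ w) + (m : ZMod N) = Multiplicative.toAdd (φ (c * w)) := by
    rw [map_mul, hcm, toAdd_mul, toAdd_ofAdd, add_comm]
  rw [e2, push_apply φ hker hκ, push_apply φ hker hκ]
  have h1 := hΦ w
  have h2 := hΦ (κ * w)
  rw [← mul_assoc, hc.comm κ, mul_assoc] at h2
  by_cases hw1 : w ∈ Φ <;> by_cases hw2 : κ * w ∈ Φ
  · rw [if_pos hw1, if_pos hw2, if_neg (h1.mp hw1), if_neg (h2.mp hw2)]; norm_num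
  · have h2' : κ * (c * w) ∈ Φ := by by_contra h; exact hw2 (h2.mpr h)
    rw [if_pos hw1, if_neg hw2, if_neg (h1.mp hw1), if_pos h2']; norm_num
  · have h1' : c * w ∈ Φ := by by_contra h; exact hw1 (h1.mpr h)
    rw [if_neg hw1, if_pos hw2, if_pos h1', if_neg (h2.mp hw2)]; norm_num
  · have h1' : c * w ∈ Φ := by by_contra h; exact hw1 (h1.mpr h)
    have h2' : κ * (c * w) ∈ Φ := by by_contra h; exact hw2 (h2.mpr h)
    rw [if_neg hw1, if_neg hw2, if_pos h1', if_pos h2']; norm_num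

omit [NeZero N] in
/-- `SumTwo` pushes forward: `∑ᵢ push φ Φ (x − φ(gᵢ)) = 4` for every `x`. -/
theorem sum_push_twists (φ : G →* Multiplicative (ZMod N)) (hφ : Surjective φ) {κ : G}
    (hker : ∀ z, φ z = 1 ↔ z = 1 ∨ z = κ) (hκ : κ ≠ 1) (Φ : Finset G) (g : Fin 4 → G)
    (hs : SumTwo (fun i => rmul Φ (g i))) (x : ZMod N) :
    ∑ i : Fin 4, push φ Φ (x - Multiplicative.toAdd (φ (g i))) = 4 := by
  obtain ⟨w, hw⟩ := hφ (Multiplicative.ofAdd x)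
  have e1 : x = Multiplicative.toAdd (φ w) := by rw [hw, toAdd_ofAdd]
  subst e1
  have e2 : ∀ i, Multiplicative.toAdd (φ w) - Multiplicative.toAdd (φ (g i)) =
      Multiplicative.toAdd (φ (w * (g i)⁻¹)) := by
    intro i; rw [map_mul, map_inv, toAdd_mul, toAdd_inv, sub_eq_add_neg]
  simp only [e2, push_apply φ hker hκ]
  rw [Finset.sum_add_distrib]
  have h3 : ∀ i, κ * (w * (g i)⁻¹) = (κ * w) * (g i)⁻¹ := fun i => by rw [mul_assoc]
  simp only [h3]
  have key : ∀ v : G, ∑ i : Fin 4, (if v * (g i)⁻¹ ∈ Φ then (1 : ℂ) else 0) = 2 := by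
    intro v
    have h := hs v
    have e : ∀ i : Fin 4, (if v * (g i)⁻¹ ∈ Φ then (1 : ℂ) else 0) =
        if v ∈ rmul Φ (g i) then 1 else 0 := by
      intro i; simp only [mem_rmul]
    simp only [e]
    rw [Finset.sum_boole, h]; norm_num
  rw [key w, key (κ * w)]; norm_num

omit [NeZero N] in
/-- If the profile is `≡ 1`, the type is `κ c`-periodic: `z ∈ Φ ↔ κ c z ∈ Φ`. -/
theorem periodic_of_push_eq_one (φ : G →* Multiplicative (ZMod N)) {κ : G}
    (hker : ∀ z, φ z = 1 ↔ z = 1 ∨ z = κ) (hκ : κ ≠ 1) {c : G} (Φ : Finset G)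
    (hΦ : IsCMType c Φ) (h1 : ∀ x, push φ Φ x = 1) (z : G) : z ∈ Φ ↔ κ * c * z ∈ Φ := by
  have hz := h1 (Multiplicative.toAdd (φ (c * z)))
  rw [push_apply φ hker hκ] at hz
  have hc1 := hΦ z
  rw [mul_assoc]
  by_cases h : z ∈ Φ
  · rw [if_neg (hc1.mp h), zero_add] at hz
    refine ⟨fun _ => ?_, fun _ => h⟩
    by_contra h2; rw [if_neg h2] at hz; norm_num at hz
  · have hcz : c * z ∈ Φ := by by_contra h2; exact h (hc1.mpr h2)
    rw [if_pos hcz] at hz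
    refine ⟨fun h2 => absurd h2 h, fun h2 => ?_⟩
    rw [if_pos h2] at hz; norm_num at hz

/-! ### Descent of a periodic type along `φ` to the cyclic theorem -/

omit [DecidableEq G] [NeZero N] in
/-- A `κ`-periodic `Φ` is the preimage of its image: `φ z ∈ φ(Φ) ↔ z ∈ Φ`. -/
theorem mem_image_iff_of_periodic (φ : G →* Multiplicative (ZMod N)) {κ : G}
    (hker : ∀ z, φ z = 1 ↔ z = 1 ∨ z = κ) (Φ : Finset G) (hper : ∀ z, z ∈ Φ ↔ κ * z ∈ Φ) (z : G) :
    φ z ∈ Φ.image φ ↔ z ∈ Φ := by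
  rw [Finset.mem_image]
  constructor
  · rintro ⟨w, hw, hwz⟩
    have h1 : φ (w * z⁻¹) = 1 := by rw [map_mul, map_inv, hwz, mul_inv_cancel]
    rcases (hker _).mp h1 with h2 | h2
    · rw [mul_inv_eq_one.mp h2] at hw; exact hw
    · have h3 : w = κ * z := by rw [← h2, inv_mul_cancel_right]
      rw [h3] at hw; exact (hper z).mpr hw
  · intro hz; exact ⟨z, hz, rfl⟩

/-- **Descent.**  A `κ`-periodic CM type with a `SumTwo` quadruple of twists on `(G, c)`, `ker φ = {1, κ}`,
`φ c = N/2`, `N = 2 · 2^a`, has a conjugate pair: the quadruple descends to `(ℤ/N, N/2)` where gen 8's cyclic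
theorem applies, and the pair pulls back. -/
theorem exists_conj_of_periodic {a : ℕ} (hN : N = 2 * 2 ^ a) (φ : G →* Multiplicative (ZMod N))
    (hφ : Surjective φ) {c : G} (hc : IsComplexConj c)
    (hcm : φ c = Multiplicative.ofAdd ((2 ^ a : ℕ) : ZMod N)) {κ : G}
    (hker : ∀ z, φ z = 1 ↔ z = 1 ∨ z = κ) (Φ : Finset G) (hΦ : IsCMType c Φ)
    (hper : ∀ z, z ∈ Φ ↔ κ * z ∈ Φ) (g : Fin 4 → G) (hs : SumTwo (fun i => rmul Φ (g i))) :
    ∃ i j : Fin 4, rmul Φ (g j) = c • rmul Φ (g i) := by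
  have hmem : ∀ z, φ z ∈ Φ.image φ ↔ z ∈ Φ := mem_image_iff_of_periodic φ hker Φ hper
  have hΦ' : IsCMType (Multiplicative.ofAdd ((2 ^ a * 3 ^ 0 : ℕ) : ZMod N)) (Φ.image φ) := by
    intro x
    obtain ⟨w, rfl⟩ := hφ x
    rw [pow_zero, mul_one, hmem, ← hcm, ← map_mul, hmem]
    exact hΦ w
  have htw : ∀ (i : Fin 4) (z : G), φ z ∈ rmul (Φ.image φ) (φ (g i)) ↔ z ∈ rmul Φ (g i) := by
    intro i z
    rw [mem_rmul, mem_rmul, ← map_inv, ← map_mul, hmem]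
  have hs' : SumTwo (fun i => rmul (Φ.image φ) (φ (g i))) := by
    intro x
    obtain ⟨w, rfl⟩ := hφ x
    rw [← hs w]
    congr 1
    ext i
    simp only [mem_filter, mem_univ, true_and]
    exact htw i w
  have hN' : N = 2 * (2 ^ a * 3 ^ 0) := by rw [hN, pow_zero, mul_one]
  obtain ⟨i, j, hij⟩ := exists_conj_of_sumTwo_cyclic Nat.prime_three (by norm_num) hN'
    (Φ.image φ) hΦ' (fun i => φ (g i)) hs'
  refine ⟨i, j, ?_⟩
  have hm : ((2 ^ a * 3 ^ 0 : ℕ) : ZMod N) = ((2 ^ a : ℕ) : ZMod N) := by rw [pow_zero, mul_one]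
  rw [hm] at hij
  ext z
  rw [← htw j z, hij, (isComplexConj_ofAdd_half hN).mem_smul_iff, ← hcm, ← map_mul, htw i (c * z),
    hc.mem_smul_iff]

/-! ### The Klein argument -/

omit [NeZero N] in
/-- A pair with `φ(gᵢ) − φ(gⱼ) = N/2` and no conjugate pair has `gᵢ gⱼ⁻¹ = κ c` (`ker φ = {1, κ}`). -/
theorem mul_inv_eq_kappa (φ : G →* Multiplicative (ZMod N)) {c : G} (hc : IsComplexConj c) {m : ℕ}
    (hcm : φ c = Multiplicative.ofAdd (m : ZMod N)) {κ : G}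
    (hker : ∀ z, φ z = 1 ↔ z = 1 ∨ z = κ) (Φ : Finset G) (g : Fin 4 → G)
    (hnc : ∀ i j : Fin 4, rmul Φ (g j) ≠ c • rmul Φ (g i)) (i j : Fin 4)
    (h : Multiplicative.toAdd (φ (g i)) - Multiplicative.toAdd (φ (g j)) = (m : ZMod N)) :
    g i * (g j)⁻¹ = κ * c := by
  have h1 : φ (g i * (g j)⁻¹ * c⁻¹) = 1 := by
    rw [map_mul, map_mul, map_inv, map_inv, hcm]
    apply Multiplicative.toAdd.injective
    rw [toAdd_mul, toAdd_mul, toAdd_inv, toAdd_inv, toAdd_ofAdd, toAdd_one]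
    linear_combination h
  rcases (hker _).mp h1 with h2 | h2
  · exfalso
    have h3 : g i = c * g j := mul_inv_eq_iff_eq_mul.mp (mul_inv_eq_one.mp h2)
    exact hnc j i (by rw [h3, rmul_mul_conj hc])
  · exact mul_inv_eq_iff_eq_mul.mp h2

/-- **Main theorem (abstract form).**  `(G, c)` with two surjections `φ₀, φ₁ : G →* ℤ/(2 · 2^a)` sending `c` to
`N/2`, kernels `{1, κ₀}`, `{1, κ₁}`, `κ₁ = κ₀ c`: every `SumTwo` quadruple of Galois twists of a CM type has two
complex-conjugate corners. -/
theorem exists_conj_of_sumTwo_kleinPair {a : ℕ} (hN : N = 2 * 2 ^ a) {c : G} (hc : IsComplexConj c)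
    (φ₀ φ₁ : G →* Multiplicative (ZMod N)) (hφ₀ : Surjective φ₀) (hφ₁ : Surjective φ₁)
    (hc₀ : φ₀ c = Multiplicative.ofAdd ((2 ^ a : ℕ) : ZMod N))
    (hc₁ : φ₁ c = Multiplicative.ofAdd ((2 ^ a : ℕ) : ZMod N))
    {κ₀ κ₁ : G} (hk₀ : ∀ z, φ₀ z = 1 ↔ z = 1 ∨ z = κ₀) (hk₁ : ∀ z, φ₁ z = 1 ↔ z = 1 ∨ z = κ₁)
    (hκ₀ : κ₀ ≠ 1) (hκ₁ : κ₁ ≠ 1) (hκ : κ₁ = κ₀ * c)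
    (Φ : Finset G) (hΦ : IsCMType c Φ) (g : Fin 4 → G) (hs : SumTwo (fun i => rmul Φ (g i))) :
    ∃ i j : Fin 4, rmul Φ (g j) = c • rmul Φ (g i) := by
  by_contra hnc'
  have hnc : ∀ i j : Fin 4, rmul Φ (g j) ≠ c • rmul Φ (g i) := fun i j h => hnc' ⟨i, j, h⟩
  have hP₀ := pairing_or_const hN (push φ₀ Φ) (push_add_half φ₀ hφ₀ hk₀ hκ₀ hc hc₀ Φ hΦ)
    (fun i => Multiplicative.toAdd (φ₀ (g i))) (sum_push_twists φ₀ hφ₀ hk₀ hκ₀ Φ g hs)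
  have hP₁ := pairing_or_const hN (push φ₁ Φ) (push_add_half φ₁ hφ₁ hk₁ hκ₁ hc hc₁ Φ hΦ)
    (fun i => Multiplicative.toAdd (φ₁ (g i))) (sum_push_twists φ₁ hφ₁ hk₁ hκ₁ Φ g hs)
  rcases hP₀ with h₀ | h₀
  · -- `Φ` is `κ₀ c = κ₁`-periodic: descend along `φ₁`
    have hper : ∀ z, z ∈ Φ ↔ κ₁ * z ∈ Φ := by
      intro z; rw [hκ]; exact periodic_of_push_eq_one φ₀ hk₀ hκ₀ Φ hΦ h₀ z
    exact hnc' (exists_conj_of_periodic hN φ₁ hφ₁ hc hc₁ hk₁ Φ hΦ hper g hs)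
  rcases hP₁ with h₁ | h₁
  · -- `Φ` is `κ₁ c = κ₀`-periodic: descend along `φ₀`
    have hper : ∀ z, z ∈ Φ ↔ κ₀ * z ∈ Φ := by
      intro z
      have h := periodic_of_push_eq_one φ₁ hk₁ hκ₁ Φ hΦ h₁ z
      rwa [hκ, mul_assoc κ₀ c c, hc.mul_self, mul_one] at h
    exact hnc' (exists_conj_of_periodic hN φ₀ hφ₀ hc hc₀ hk₀ Φ hΦ hper g hs)
  -- both pairings
  have K₀ : ∀ i j : Fin 4, Multiplicative.toAdd (φ₀ (g i)) - Multiplicative.toAdd (φ₀ (g j)) =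
      ((2 ^ a : ℕ) : ZMod N) → g i * (g j)⁻¹ = κ₁ := fun i j h => by
    rw [hκ]; exact mul_inv_eq_kappa φ₀ hc hc₀ hk₀ Φ g hnc i j h
  have K₁ : ∀ i j : Fin 4, Multiplicative.toAdd (φ₁ (g i)) - Multiplicative.toAdd (φ₁ (g j)) =
      ((2 ^ a : ℕ) : ZMod N) → g i * (g j)⁻¹ = κ₀ := fun i j h => by
    have h' := mul_inv_eq_kappa φ₁ hc hc₁ hk₁ Φ g hnc i j h
    rwa [hκ, mul_assoc κ₀ c c, hc.mul_self, mul_one] at h'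
  have hκ₀sq : κ₀ * κ₀ = 1 := by
    have h1 : φ₀ (κ₀ * κ₀) = 1 := by rw [map_mul, (hk₀ κ₀).mpr (Or.inr rfl), one_mul]
    rcases (hk₀ _).mp h1 with h2 | h2
    · exact h2
    · exact absurd (mul_eq_left.mp h2) hκ₀
  have hκ₀inv : κ₀⁻¹ = κ₀ := inv_eq_of_mul_eq_one_right hκ₀sq
  have hκκ : κ₁ * κ₀ = c := by rw [hκ, mul_assoc, hc.comm κ₀, ← mul_assoc, hκ₀sq, one_mul]
  have hne : κ₁ ≠ κ₀ := by
    intro h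
    apply hc.ne_one
    have h' : κ₀ * c = κ₀ * 1 := by rw [mul_one, ← hκ, h]
    exact mul_left_cancel h'
  have chain : ∀ i j k : Fin 4, g i * (g j)⁻¹ = κ₁ → g j * (g k)⁻¹ = κ₀ → False := by
    intro i j k h1 h2
    apply hnc k i
    have h3 : g i = c * g k := by
      rw [← hκκ, ← h1, ← h2]; group
    rw [h3, rmul_mul_conj hc]
  have flip : ∀ j k : Fin 4, g k * (g j)⁻¹ = κ₀ → g j * (g k)⁻¹ = κ₀ := by
    intro j k h
    rw [← hκ₀inv, ← h, mul_inv_rev, inv_inv]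
  rcases h₀ with ⟨h01, h23⟩ | ⟨h02, h13⟩ | ⟨h03, h12⟩ <;>
    rcases h₁ with ⟨h01', h23'⟩ | ⟨h02', h13'⟩ | ⟨h03', h12'⟩
  · exact hne ((K₀ 0 1 h01).symm.trans (K₁ 0 1 h01'))
  · exact chain 0 1 3 (K₀ 0 1 h01) (K₁ 1 3 h13')
  · exact chain 0 1 2 (K₀ 0 1 h01) (K₁ 1 2 h12')
  · exact chain 0 2 3 (K₀ 0 2 h02) (K₁ 2 3 h23')
  · exact hne ((K₀ 0 2 h02).symm.trans (K₁ 0 2 h02'))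
  · exact chain 0 2 1 (K₀ 0 2 h02) (flip 2 1 (K₁ 1 2 h12'))
  · exact chain 0 3 2 (K₀ 0 3 h03) (flip 3 2 (K₁ 2 3 h23'))
  · exact chain 0 3 1 (K₀ 0 3 h03) (flip 3 1 (K₁ 1 3 h13'))
  · exact hne ((K₀ 0 3 h03).symm.trans (K₁ 0 3 h03'))

end HodgeRepro.TwoPowerTimesTwo
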